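import Mathlib.Geometry.Manifold.ContMDiff.Atlas
import Mathlib.Geometry.Manifold.IsManifold.ExtChartAt
import Mathlib.Analysis.Normed.Module.FiniteDimension
import Mathlib.Topology.Algebra.Module.Determinant
import HarnessLib

/-!
# Framed charts: extended charts followed by an affine isomorphism onto a fixed model
# (topic `Geometry/Manifold`)

Geometric layer of the programme to prove short-time existence for quasilinear strictly
parabolic systems on a closed manifold (hypothesis `hQL` of
`Literature.Geometry.Riemannian.ricciFlow_shortTime_existence_of_quasilinear`). All analysis of
that programme happens in ONE Euclidean model space `E'` through finitely many charts of the
form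

  `x ↦ A (extChartAt I z x) + c`,  `A : E ≃L[ℝ] E'`, `c : E'`

(the extended chart at a point `z`, followed by an affine isomorphism which fixes a frame
adapted to the principal symbol and recentres the patch). This file introduces these
**framed charts** (`FramedChart`) and their elementary calculus: source/target and the inverse
map, openness, the bridge from `ContMDiff` to smoothness of chart expressions
(`contDiffOn_comp_inv`), the transition maps between two framed charts
(`FramedChart.transition`: smooth, injective, with inverse transition and derivative of
non-vanishing determinant on the overlap — the hypotheses of the Sobolev transport lemma
`Literature.Analysis.PDE.sobolevEnergy_smul_comp_le`), and the transfer of compact sets.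

Everything is proved; no named fact and no `sorry` is introduced.

## References

* J. M. Lee, *Introduction to Smooth Manifolds*, 2nd ed., Springer 2013, Ch. 1 (smooth
  structures, transition maps). [Lee2013]
-/

noncomputable section

open Set Function Filter Topology
open scoped Manifold ContDiff Topology

namespace Literature.Geometry.Manifold

variable {E : Type*} [NormedAddCommGroup E] [NormedSpace ℝ E] {H : Type*} [TopologicalSpace H]

/-- **A framed chart**: the data `(z, A, c)` of a base point `z : M`, a continuous linear
isomorphism `A : E ≃L[ℝ] E'` onto the model `E'` and a translation `c : E'`; its chart map is
`x ↦ A (extChartAt I z x) + c` on the source of the extended chart at `z` (the model with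
corners `I` is a parameter of the structure, used by the chart map). [cite: Lee2013, Ch. 1] -/
@[nolint unusedArguments]
structure FramedChart (I : ModelWithCorners ℝ E H) (M : Type*) [TopologicalSpace M]
    [ChartedSpace H M] (E' : Type*) [NormedAddCommGroup E'] [NormedSpace ℝ E'] where
  /-- the base point whose extended chart is used -/
  z : M
  /-- the frame: a continuous linear isomorphism onto the model space -/
  A : E ≃L[ℝ] E'
  /-- the recentring translation -/
  c : E'

namespace FramedChart

variable {I : ModelWithCorners ℝ E H} {M : Type*} [TopologicalSpace M] [ChartedSpace H M]
  {E' : Type*} [NormedAddCommGroup E'] [NormedSpace ℝ E']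
variable (κ κ' : FramedChart I M E')

/-- The chart map `x ↦ A (extChartAt I z x) + c`. [cite: Lee2013, Ch. 1] -/
def map (x : M) : E' := κ.A (extChartAt I κ.z x) + κ.c

/-- The inverse chart map `y ↦ (extChartAt I z)⁻¹ (A⁻¹ (y - c))`. [cite: Lee2013, Ch. 1] -/
def inv (y : E') : M := (extChartAt I κ.z).symm (κ.A.symm (y - κ.c))

/-- The source: the source of the extended chart at the base point. [cite: Lee2013, Ch. 1] -/
def source : Set M := (extChartAt I κ.z).source

/-- The target: the affine image of the target of the extended chart. [cite: Lee2013, Ch. 1] -/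
def target : Set E' := (fun y : E ↦ κ.A y + κ.c) '' (extChartAt I κ.z).target

/-- `map_apply`: map apply. [folklore] -/
theorem map_apply (x : M) : κ.map x = κ.A (extChartAt I κ.z x) + κ.c := rfl

/-- `inv_apply`: inv apply. [folklore] -/
theorem inv_apply (y : E') : κ.inv y = (extChartAt I κ.z).symm (κ.A.symm (y - κ.c)) := rfl

/-- `source_eq`: source eq. [folklore] -/
theorem source_eq : κ.source = (extChartAt I κ.z).source := rfl

/-- The affine part is inverted by `y ↦ A⁻¹ (y - c)`. [folklore] -/
theorem affine_symm_apply (y : E) : κ.A.symm (κ.A y + κ.c - κ.c) = y := by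
  rw [add_sub_cancel_right, ContinuousLinearEquiv.symm_apply_apply]

/-- `affine_apply_symm`: affine apply symm. [folklore] -/
theorem affine_apply_symm (y : E') : κ.A (κ.A.symm (y - κ.c)) + κ.c = y := by
  rw [ContinuousLinearEquiv.apply_symm_apply, sub_add_cancel]

/-- Membership in the target. [folklore] -/
theorem mem_target_iff (y : E') : y ∈ κ.target ↔ κ.A.symm (y - κ.c) ∈ (extChartAt I κ.z).target := by
  constructor
  · rintro ⟨y', hy', rfl⟩
    rwa [affine_symm_apply]
  · intro h
    exact ⟨_, h, κ.affine_apply_symm y⟩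

/-- `isOpen_source`: isOpen source. [folklore] -/
theorem isOpen_source : IsOpen κ.source := isOpen_extChartAt_source κ.z

/-- `mem_source`: mem source. [folklore] -/
theorem mem_source : κ.z ∈ κ.source := mem_extChartAt_source κ.z

/-- The affine part is a homeomorphism, so the target is open (boundaryless model).
[folklore] -/
theorem isOpen_target [I.Boundaryless] : IsOpen κ.target := by
  have h : κ.target = (fun y : E' ↦ κ.A.symm (y - κ.c)) ⁻¹' (extChartAt I κ.z).target := by
    ext y; exact κ.mem_target_iff y
  rw [h]
  exact (isOpen_extChartAt_target κ.z).preimage (κ.A.symm.continuous.comp (continuous_sub_right _))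

/-- `map_mem_target`: map mem target. [folklore] -/
theorem map_mem_target {x : M} (hx : x ∈ κ.source) : κ.map x ∈ κ.target :=
  ⟨_, (extChartAt I κ.z).map_source hx, rfl⟩

/-- `map_base_mem_target`: map base mem target. [folklore] -/
theorem map_base_mem_target : κ.map κ.z ∈ κ.target := κ.map_mem_target κ.mem_source

/-- `inv_mem_source`: inv mem source. [folklore] -/
theorem inv_mem_source {y : E'} (hy : y ∈ κ.target) : κ.inv y ∈ κ.source :=
  (extChartAt I κ.z).map_target ((κ.mem_target_iff y).1 hy)

/-- `inv ∘ map = id` on the source. [folklore] -/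
theorem inv_map {x : M} (hx : x ∈ κ.source) : κ.inv (κ.map x) = x := by
  rw [inv_apply, map_apply, affine_symm_apply]
  exact (extChartAt I κ.z).left_inv hx

/-- `map ∘ inv = id` on the target. [folklore] -/
theorem map_inv {y : E'} (hy : y ∈ κ.target) : κ.map (κ.inv y) = y := by
  rw [map_apply, inv_apply, (extChartAt I κ.z).right_inv ((κ.mem_target_iff y).1 hy)]
  exact κ.affine_apply_symm y

/-- `injOn_map`: injOn map. [folklore] -/
theorem injOn_map : InjOn κ.map κ.source := fun x hx x' hx' h ↦ by
  rw [← κ.inv_map hx, ← κ.inv_map hx', h]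

/-- `injOn_inv`: injOn inv. [folklore] -/
theorem injOn_inv : InjOn κ.inv κ.target := fun y hy y' hy' h ↦ by
  rw [← κ.map_inv hy, ← κ.map_inv hy', h]

/-- The target is the image of the source. [folklore] -/
theorem target_eq_image : κ.target = κ.map '' κ.source := by
  ext y
  constructor
  · intro hy
    exact ⟨κ.inv y, κ.inv_mem_source hy, κ.map_inv hy⟩
  · rintro ⟨x, hx, rfl⟩
    exact κ.map_mem_target hx

/-- `mapsTo_map`: mapsTo map. [folklore] -/
theorem mapsTo_map : MapsTo κ.map κ.source κ.target := fun _ hx ↦ κ.map_mem_target hx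

/-- `mapsTo_inv`: mapsTo inv. [folklore] -/
theorem mapsTo_inv : MapsTo κ.inv κ.target κ.source := fun _ hy ↦ κ.inv_mem_source hy

/-- The preimage of a subset of the target under `map`, inside the source, is its image under
`inv`. [folklore] -/
theorem image_inv_eq {S : Set E'} (hS : S ⊆ κ.target) : κ.inv '' S = κ.source ∩ κ.map ⁻¹' S := by
  ext x
  constructor
  · rintro ⟨y, hy, rfl⟩
    exact ⟨κ.inv_mem_source (hS hy), by rw [mem_preimage, κ.map_inv (hS hy)]; exact hy⟩
  · rintro ⟨hx, hxS⟩
    exact ⟨κ.map x, hxS, κ.inv_map hx⟩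

/-- `image_map_eq`: image map eq. [folklore] -/
theorem image_map_eq {S : Set M} (hS : S ⊆ κ.source) : κ.map '' S = κ.target ∩ κ.inv ⁻¹' S := by
  ext y
  constructor
  · rintro ⟨x, hx, rfl⟩
    exact ⟨κ.map_mem_target (hS hx), by rw [mem_preimage, κ.inv_map (hS hx)]; exact hx⟩
  · rintro ⟨hy, hyS⟩
    exact ⟨κ.inv y, hyS, κ.map_inv hy⟩

/-! ### Continuity and smoothness of chart expressions -/

/-- `continuousOn_map`: continuousOn map. [folklore] -/
theorem continuousOn_map : ContinuousOn κ.map κ.source :=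
  ((κ.A.continuous.comp_continuousOn (continuousOn_extChartAt κ.z)).add continuousOn_const)

/-- `continuousOn_inv`: continuousOn inv. [folklore] -/
theorem continuousOn_inv : ContinuousOn κ.inv κ.target := by
  refine (continuousOn_extChartAt_symm κ.z).comp
    ((κ.A.symm.continuous.comp (continuous_sub_right _)).continuousOn) fun y hy ↦ ?_
  exact (κ.mem_target_iff y).1 hy

/-- An open subset of the source has open image. [folklore] -/
theorem isOpen_image_of_subset_source [I.Boundaryless] {S : Set M} (hS : IsOpen S)
    (hSs : S ⊆ κ.source) : IsOpen (κ.map '' S) := by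
  rw [κ.image_map_eq hSs]
  exact κ.continuousOn_inv.isOpen_inter_preimage κ.isOpen_target hS

/-- An open subset of the target has open preimage in the source. [folklore] -/
theorem isOpen_source_inter_preimage {S : Set E'} (hS : IsOpen S) :
    IsOpen (κ.source ∩ κ.map ⁻¹' S) :=
  κ.continuousOn_map.isOpen_inter_preimage κ.isOpen_source hS

/-- **Chart expressions of smooth maps are smooth**: if `f : M → F` is `C^n` then `f ∘ inv` is
`C^n` on the target. [cite: Lee2013, Ch. 1] -/
theorem contDiffOn_comp_inv {n : WithTop ℕ∞} [IsManifold I n M] {F : Type*}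
    [NormedAddCommGroup F] [NormedSpace ℝ F] {f : M → F} (hf : ContMDiff I 𝓘(ℝ, F) n f) :
    ContDiffOn ℝ n (f ∘ κ.inv) κ.target := by
  -- the chart expression in the extended chart at `z`
  have h1 : ContDiffOn ℝ n (f ∘ (extChartAt I κ.z).symm) (extChartAt I κ.z).target := by
    have h := (contMDiffOn_iff.1 (hf.contMDiffOn (s := univ))).2 κ.z (f κ.z)
    simp only [extChartAt_model_space_eq_id, PartialEquiv.refl_coe, PartialEquiv.refl_source,
      preimage_univ, inter_univ, id_comp] at h
    exact h
  -- compose with the affine isomorphism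
  have h2 : ContDiff ℝ n fun y : E' ↦ κ.A.symm (y - κ.c) :=
    κ.A.symm.contDiff.comp (contDiff_id.sub contDiff_const)
  have h := h1.comp h2.contDiffOn fun y hy ↦ (κ.mem_target_iff y).1 hy
  exact h

/-- Chart expressions of maps smooth on an open set. [cite: Lee2013, Ch. 1] -/
theorem contDiffOn_comp_inv_of_contMDiffOn {n : WithTop ℕ∞} [IsManifold I n M] {F : Type*}
    [NormedAddCommGroup F] [NormedSpace ℝ F] {f : M → F} {S : Set M}
    (hf : ContMDiffOn I 𝓘(ℝ, F) n f S) :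
    ContDiffOn ℝ n (f ∘ κ.inv) (κ.target ∩ κ.inv ⁻¹' S) := by
  have h1 : ContDiffOn ℝ n (f ∘ (extChartAt I κ.z).symm)
      ((extChartAt I κ.z).target ∩ (extChartAt I κ.z).symm ⁻¹' S) := by
    have h := (contMDiffOn_iff.1 hf).2 κ.z (f κ.z)
    simp only [extChartAt_model_space_eq_id, PartialEquiv.refl_coe, PartialEquiv.refl_source,
      preimage_univ, inter_univ, id_comp] at h
    exact h
  have h2 : ContDiff ℝ n fun y : E' ↦ κ.A.symm (y - κ.c) :=
    κ.A.symm.contDiff.comp (contDiff_id.sub contDiff_const)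
  refine h1.comp h2.contDiffOn fun y hy ↦ ⟨(κ.mem_target_iff y).1 hy.1, ?_⟩
  exact hy.2

/-! ### Transition maps -/

/-- The transition map from the chart `κ` to the chart `κ'`: `κ'.map ∘ κ.inv`.
[cite: Lee2013, Ch. 1] -/
def transition (κ κ' : FramedChart I M E') (y : E') : E' := κ'.map (κ.inv y)

/-- The domain of the transition map: the image under `κ` of the common source.
[cite: Lee2013, Ch. 1] -/
def overlap (κ κ' : FramedChart I M E') : Set E' := κ.map '' (κ.source ∩ κ'.source)

/-- `transition_apply`: transition apply. [folklore] -/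
theorem transition_apply (y : E') : κ.transition κ' y = κ'.map (κ.inv y) := rfl

/-- `overlap_subset_target`: overlap subset target. [folklore] -/
theorem overlap_subset_target : κ.overlap κ' ⊆ κ.target := by
  rintro y ⟨x, hx, rfl⟩
  exact κ.map_mem_target hx.1

/-- `mem_overlap_iff`: mem overlap iff. [folklore] -/
theorem mem_overlap_iff {y : E'} : y ∈ κ.overlap κ' ↔ y ∈ κ.target ∧ κ.inv y ∈ κ'.source := by
  constructor
  · rintro ⟨x, hx, rfl⟩
    exact ⟨κ.map_mem_target hx.1, by rw [κ.inv_map hx.1]; exact hx.2⟩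
  · rintro ⟨hy, hy'⟩
    exact ⟨κ.inv y, ⟨κ.inv_mem_source hy, hy'⟩, κ.map_inv hy⟩

/-- `overlap_eq`: overlap eq. [folklore] -/
theorem overlap_eq : κ.overlap κ' = κ.target ∩ κ.inv ⁻¹' κ'.source := by
  ext y; exact κ.mem_overlap_iff κ'

/-- `isOpen_overlap`: isOpen overlap. [folklore] -/
theorem isOpen_overlap [I.Boundaryless] : IsOpen (κ.overlap κ') :=
  κ.isOpen_image_of_subset_source (κ.isOpen_source.inter κ'.isOpen_source) inter_subset_left

/-- `map_mem_overlap`: map mem overlap. [folklore] -/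
theorem map_mem_overlap {x : M} (hx : x ∈ κ.source) (hx' : x ∈ κ'.source) :
    κ.map x ∈ κ.overlap κ' := ⟨x, ⟨hx, hx'⟩, rfl⟩

/-- The transition map sends the overlap into the opposite overlap. [folklore] -/
theorem transition_mem_overlap {y : E'} (hy : y ∈ κ.overlap κ') :
    κ.transition κ' y ∈ κ'.overlap κ := by
  obtain ⟨hy, hy'⟩ := (κ.mem_overlap_iff κ').1 hy
  exact κ'.map_mem_overlap κ hy' (κ.inv_mem_source hy)

/-- `mapsTo_transition`: mapsTo transition. [folklore] -/
theorem mapsTo_transition : MapsTo (κ.transition κ') (κ.overlap κ') (κ'.overlap κ) :=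
  fun _ hy ↦ κ.transition_mem_overlap κ' hy

/-- The two transition maps are inverse to each other. [cite: Lee2013, Ch. 1] -/
theorem transition_transition {y : E'} (hy : y ∈ κ.overlap κ') :
    κ'.transition κ (κ.transition κ' y) = y := by
  obtain ⟨hy, hy'⟩ := (κ.mem_overlap_iff κ').1 hy
  rw [transition_apply, transition_apply, κ'.inv_map hy', κ.map_inv hy]

/-- `injOn_transition`: injOn transition. [folklore] -/
theorem injOn_transition : InjOn (κ.transition κ') (κ.overlap κ') := fun y hy y' hy' h ↦ by
  rw [← κ.transition_transition κ' hy, ← κ.transition_transition κ' hy', h]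

/-- `transition_eq_on_overlap`: transition eq on overlap. [folklore] -/
theorem transition_eq_on_overlap {y : E'} (hy : y ∈ κ.overlap κ') :
    κ'.inv (κ.transition κ' y) = κ.inv y := by
  obtain ⟨_, hy'⟩ := (κ.mem_overlap_iff κ').1 hy
  rw [transition_apply, κ'.inv_map hy']

/-- The image of the overlap under the transition map is the opposite overlap. [folklore] -/
theorem image_transition_overlap : κ.transition κ' '' κ.overlap κ' = κ'.overlap κ := by
  refine Subset.antisymm (fun y' ⟨y, hy, h⟩ ↦ h ▸ κ.transition_mem_overlap κ' hy) fun y' hy' ↦ ?_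
  exact ⟨κ'.transition κ y', κ'.transition_mem_overlap κ hy', κ'.transition_transition κ hy'⟩

/-- `continuousOn_transition`: continuousOn transition. [folklore] -/
theorem continuousOn_transition : ContinuousOn (κ.transition κ') (κ.overlap κ') := by
  refine κ'.continuousOn_map.comp (κ.continuousOn_inv.mono (κ.overlap_subset_target κ')) ?_
  intro y hy
  exact ((κ.mem_overlap_iff κ').1 hy).2

/-- **Transition maps are smooth.** [cite: Lee2013, Ch. 1] -/
theorem contDiffOn_transition {n : WithTop ℕ∞} [IsManifold I n M] :
    ContDiffOn ℝ n (κ.transition κ') (κ.overlap κ') := by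
  -- the extended coordinate change
  have h1 := contDiffOn_ext_coord_change (I := I) (n := n) κ'.z κ.z
  have h2 : ContDiff ℝ n fun y : E' ↦ κ.A.symm (y - κ.c) :=
    κ.A.symm.contDiff.comp (contDiff_id.sub contDiff_const)
  have h3 : ContDiff ℝ n fun y : E ↦ κ'.A y + κ'.c := κ'.A.contDiff.add contDiff_const
  have h : ContDiffOn ℝ n ((fun y : E ↦ κ'.A y + κ'.c) ∘
      (extChartAt I κ'.z ∘ (extChartAt I κ.z).symm) ∘ fun y : E' ↦ κ.A.symm (y - κ.c))
      (κ.overlap κ') := by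
    refine h3.comp_contDiffOn (h1.comp h2.contDiffOn fun y hy ↦ ?_)
    obtain ⟨hy, hy'⟩ := (κ.mem_overlap_iff κ').1 hy
    refine ⟨(κ.mem_target_iff y).1 hy, ?_⟩
    simp only [mem_preimage]
    exact hy'
  exact h

/-- **The derivative of a transition map has non-vanishing determinant** (finite-dimensional
model): it is inverted by the derivative of the opposite transition map.
[cite: Lee2013, Ch. 1] -/
theorem det_fderiv_transition_ne_zero [IsManifold I ∞ M] [I.Boundaryless]
    [FiniteDimensional ℝ E'] {y : E'} (hy : y ∈ κ.overlap κ') :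
    (fderiv ℝ (κ.transition κ') y).det ≠ 0 := by
  have hO := κ.isOpen_overlap κ'
  have hO' := κ'.isOpen_overlap κ
  have hy' : κ.transition κ' y ∈ κ'.overlap κ := κ.transition_mem_overlap κ' hy
  have hd : DifferentiableAt ℝ (κ.transition κ') y :=
    (((κ.contDiffOn_transition κ' (n := ∞)).differentiableOn (by simp)) y hy).differentiableAt
      (hO.mem_nhds hy)
  have hd' : DifferentiableAt ℝ (κ'.transition κ) (κ.transition κ' y) :=
    (((κ'.contDiffOn_transition κ (n := ∞)).differentiableOn (by simp)) _ hy').differentiableAt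
      (hO'.mem_nhds hy')
  -- `τ' ∘ τ = id` near `y`
  have hev : (κ'.transition κ ∘ κ.transition κ') =ᶠ[𝓝 y] id := by
    filter_upwards [hO.mem_nhds hy] with y₁ hy₁
    exact κ.transition_transition κ' hy₁
  have hcomp : fderiv ℝ (κ'.transition κ ∘ κ.transition κ') y = ContinuousLinearMap.id ℝ E' := by
    rw [hev.fderiv_eq, fderiv_id]
  rw [fderiv_comp y hd' hd] at hcomp
  intro h0
  have h1 : LinearMap.det ((fderiv ℝ (κ'.transition κ) (κ.transition κ' y) : E' →ₗ[ℝ] E').comp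
      (fderiv ℝ (κ.transition κ') y : E' →ₗ[ℝ] E')) = 1 := by
    have h2 : ((fderiv ℝ (κ'.transition κ) (κ.transition κ' y)).comp
        (fderiv ℝ (κ.transition κ') y)).det = 1 := by
      rw [hcomp]
      exact LinearMap.det_id
    exact h2
  have h0' : LinearMap.det (fderiv ℝ (κ.transition κ') y : E' →ₗ[ℝ] E') = 0 := h0
  rw [LinearMap.det_comp, h0', mul_zero] at h1
  exact zero_ne_one h1

/-! ### Compact sets -/

/-- The `inv`-image of a compact subset of the target is a compact subset of the source.
[folklore] -/
theorem isCompact_image_inv {K : Set E'} (hK : IsCompact K) (hKt : K ⊆ κ.target) :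
    IsCompact (κ.inv '' K) ∧ κ.inv '' K ⊆ κ.source :=
  ⟨hK.image_of_continuousOn (κ.continuousOn_inv.mono hKt),
    fun _ ⟨_, hy, h⟩ ↦ h ▸ κ.inv_mem_source (hKt hy)⟩

/-- The `map`-image of a compact subset of the source is a compact subset of the target.
[folklore] -/
theorem isCompact_image_map {K : Set M} (hK : IsCompact K) (hKs : K ⊆ κ.source) :
    IsCompact (κ.map '' K) ∧ κ.map '' K ⊆ κ.target :=
  ⟨hK.image_of_continuousOn (κ.continuousOn_map.mono hKs),
    fun _ ⟨_, hx, h⟩ ↦ h ▸ κ.map_mem_target (hKs hx)⟩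

/-- A compact subset of the target which `inv` maps into the source of `κ'` lies in the overlap,
and its transition image is a compact subset of the opposite overlap. [folklore] -/
theorem isCompact_image_transition [IsManifold I ∞ M] {K : Set E'} (hK : IsCompact K)
    (hKo : K ⊆ κ.overlap κ') :
    IsCompact (κ.transition κ' '' K) ∧ κ.transition κ' '' K ⊆ κ'.overlap κ :=
  ⟨hK.image_of_continuousOn ((κ.continuousOn_transition κ').mono hKo),
    fun _ ⟨_, hy, h⟩ ↦ h ▸ κ.transition_mem_overlap κ' (hKo hy)⟩

/-- Around every point there is a closed ball of the model inside the target of the framed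
chart based at that point. [folklore] -/
theorem exists_closedBall_subset_target [I.Boundaryless] :
    ∃ r : ℝ, 0 < r ∧ Metric.closedBall (κ.map κ.z) r ⊆ κ.target := by
  obtain ⟨r, hr, h⟩ := Metric.nhds_basis_closedBall.mem_iff.1
    (κ.isOpen_target.mem_nhds κ.map_base_mem_target)
  exact ⟨r, hr, h⟩

end FramedChart

end Literature.Geometry.Manifold

end
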